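import Summits.HodgeConjecture.HodgeConjecture.Theses.AnchorTransport
import Summits.HodgeConjecture.HodgeConjecture.Theorems.PadicSemiregularLiftHodgeAbelianVarietiesStubVhcFromCMFibre
import Literature.AlgebraicGeometry.HodgeTheory.SemiregularVariationalHodge
import Literature.AlgebraicGeometry.HodgeTheory.MotivatedClassesDeformationInputs
import Literature.AlgebraicGeometry.Motives.ComplexPointsManifold
import Mathlib.Topology.Connected.LocallyPathConnected

/-!
# Route AnchorTransport — `VariationalHodge` (stmt-HodgeConjecture-1076): the semiregular case, globalised

The one general mechanism known towards Grothendieck's variational Hodge conjecture is Bloch's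
semiregularity (Bloch 1972; Buchweitz–Flenner 2003, Thm. 5.1; Pridham; Perry 2026): the Chern
character of a SEMIREGULAR sheaf on the anchor fibre stays algebraic under deformation as long as it
stays of Hodge type. The tree carries Buchweitz–Flenner's theorem as the named fact
`BuchweitzFlenner2003_variationalHodge_semiregular` — a LOCAL statement (algebraicity of the flat
transports of `ch₁(ℰ₀)`, `ch₂(ℰ₀)` on the fibres over some Euclidean neighbourhood `W` of the anchor).
This file globalises it on the real carriers of the crux `AnchorTransport.VariationalHodge`
(global classes `A ∈ H²ᵖ(𝒳(ℂ); ℂ)` and their fibre restrictions):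

* `variationalHodge_conclusion_two_of_semiregular` — for a smooth projective family `f : 𝒳 ⟶ S` with
  quasi-projective total space over a smooth irreducible quasi-projective base (smooth of some relative
  dimension `d`), global classes `A₁ ∈ H²(𝒳(ℂ); ℂ)`, `A₂ ∈ H⁴(𝒳(ℂ); ℂ)` whose fibre restrictions are of
  Hodge type `(1,1)`, `(2,2)` everywhere, and an anchor `s₀` at which `A₁|_{𝒳_{s₀}} = ch₁(ℰ₀)`,
  `A₂|_{𝒳_{s₀}} = ch₂(ℰ₀)` for a finite locally free `{0,1}`-semiregular `ℰ₀` on `𝒳_{s₀}`: **`A₂|_{𝒳_t}`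
  (and `A₁|_{𝒳_t}`) is an algebraic class for EVERY `t ∈ S(ℂ)`**, granted the two named facts
  `BuchweitzFlenner2003_variationalHodge_semiregular` (Compositio 2003, Thm. 5.1) and
  `charlesSchnell_algebraicityLocus_iUnion_closed` (relative Hilbert schemes).

Proof. `R⁴ f_* ℂ` is a local system on `S(ℂ)` (Ehresmann, the tree's PROVED
`isCohomologicallyLocallyTrivialOn_univ_of_isSmoothProjectiveFamily`) and the transport of `A|_{𝒳_s}`
along any path is `A|_{𝒳_t}` (`transportFun_map_fiberι`), so the Hodge hypotheses of the fact are the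
fibrewise Hodge hypotheses of the crux, and its conclusion says `A₂|_{𝒳_t}` is algebraic for every `t`
joined to `s₀` inside `W`. The path component of `s₀` in `W` is a non-empty Euclidean-OPEN subset of
`S(ℂ)` (`S(ℂ)` is a topological manifold, hence locally path connected), so the Baire/Hilbert-scheme
closing (`map_fiberι_mem_algebraicClasses_of_isOpen`, route `PadicSemiregularLift`, PROVED modulo the
Hilbert-scheme fact) spreads algebraicity to all of `S(ℂ)`. In degree `2` this is the case
`I = {1,2}`, `B₀ = 0` of Perry's global Thm. 1.1 (2) (an unrefereed `[claim]` in the tree), here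
DERIVED from the 2003 theorem and the closing lemma instead of assumed.

This is the crux's conclusion for `p = 2` — the first open codimension
(`AnchorTransportVariationalHodgeLefschetzRange`) — at SEMIREGULAR anchors; producing semiregular
representatives is exactly what "general principles do not give" (Voisin, Torino lectures, L3 §0).
-/

noncomputable section

-- every declaration of this problem lives in `Summit.HodgeConjecture.HodgeConjecture.…` (summit = sub-problem)
set_option linter.dupNamespace false

open CategoryTheory AlgebraicGeometry TopologicalSpace
open Literature.AlgebraicGeometry.Motives Literature.AlgebraicGeometry.HodgeTheory
open Summit.HodgeConjecture.HodgeConjecture.Cruxes.HodgeAbelianVarieties.SubtorusGalleryBlochSeeds.Stubs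
  (exists_eq_univ_of_isOpen_subset_iUnion map_fiberι_mem_algebraicClasses_of_isOpen)

namespace Summit.HodgeConjecture.HodgeConjecture.Theorems

variable {n d : ℕ} {𝒳 S : SchemeOver ℂ} (f : 𝒳 ⟶ S)

/-- **Buchweitz–Flenner at an anchor of a global class, local form on real carriers.** For a smooth
projective family over a smooth quasi-projective base (smooth of relative dimension `d`), global classes
`A₁`, `A₂` of fibrewise Hodge types `(1,1)`, `(2,2)`, and an anchor `s₀` where they restrict to
`ch₁(ℰ₀)`, `ch₂(ℰ₀)` of a finite locally free `{0,1}`-semiregular `ℰ₀`: there is a Euclidean-open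
`W ∋ s₀` such that `A₁|_{𝒳_t}` and `A₂|_{𝒳_t}` are algebraic for every `t` in the path component of `s₀`
in `W` (transports of restrictions of global classes are restrictions, `transportFun_map_fiberι`).
[cite: BuchweitzFlenner2003, §5 Thm. 5.1] [cite: VoisinHodgeII2003, §3.1.2] -/
theorem exists_isOpen_forall_mem_algebraicClasses_of_semiregular
    (hBF : BuchweitzFlenner2003_variationalHodge_semiregular) (C : ChernCharacterBetti)
    (hf : IsSmoothProjectiveFamily f n) (hS : IsQuasiProjectiveOver S)
    (hSsm : AlgebraicGeometry.Smooth S.hom) [SmoothOfRelativeDimension d S.hom]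
    (A₁ : complexBetti 𝒳 (2 * 1)) (A₂ : complexBetti 𝒳 (2 * 2))
    (hA₁ : ∀ t : ComplexPoints S,
      IsOfHodgeType n (fiberOver f t) (2 * 1) 1 1 (complexBetti.map (fiberι f t) (2 * 1) A₁))
    (hA₂ : ∀ t : ComplexPoints S,
      IsOfHodgeType n (fiberOver f t) (2 * 2) 2 2 (complexBetti.map (fiberι f t) (2 * 2) A₂))
    (s₀ : ComplexPoints S) (E₀ : (fiberOver f s₀).left.Modules) (hE₀ : IsFiniteLocallyFree E₀)
    (hsr : IsZeroOneSemiregular hE₀)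
    (h₁ : C.ch (fiberOver f s₀) E₀ 1 = complexBetti.map (fiberι f s₀) (2 * 1) A₁)
    (h₂ : C.ch (fiberOver f s₀) E₀ 2 = complexBetti.map (fiberι f s₀) (2 * 2) A₂) :
    ∃ W : Set (ComplexPoints S), IsOpen W ∧ s₀ ∈ W ∧ ∀ t ∈ pathComponentIn W s₀,
      complexBetti.map (fiberι f t) (2 * 1) A₁ ∈ algebraicClasses (fiberOver f t) 1 ∧
        complexBetti.map (fiberι f t) (2 * 2) A₂ ∈ algebraicClasses (fiberOver f t) 2 := by
  have hU := isCohomologicallyLocallyTrivialOn_univ_of_isSmoothProjectiveFamily f d hf hS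
  -- the Hodge hypotheses of the fact are those of the crux, by flatness of restrictions
  have hHodge : ∀ (t : (Set.univ : Set (ComplexPoints S)))
      (γ : Path.Homotopic.Quotient (⟨s₀, Set.mem_univ s₀⟩ : (Set.univ : Set (ComplexPoints S))) t),
      IsOfHodgeType n (fiberOver f t.1) (2 * 1) 1 1
          (transportFun f (2 * 1) hU γ (C.ch (fiberOver f s₀) E₀ 1)) ∧
        IsOfHodgeType n (fiberOver f t.1) (2 * 2) 2 2
          (transportFun f (2 * 2) hU γ (C.ch (fiberOver f s₀) E₀ 2)) := by
    intro t γ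
    rw [h₁, h₂, transportFun_map_fiberι f (2 * 1) hU γ A₁, transportFun_map_fiberι f (2 * 2) hU γ A₂]
    exact ⟨hA₁ t.1, hA₂ t.1⟩
  obtain ⟨W, hWo, hW₀, hWU, hW⟩ := hBF C f n hf hSsm hU ⟨s₀, Set.mem_univ s₀⟩ E₀ hE₀ hsr hHodge
  refine ⟨W, hWo, hW₀, fun t ht => ?_⟩
  -- a path from `s₀` to `t` inside `W`
  have hj : JoinedIn W s₀ t := ht
  obtain ⟨γ⟩ := hj.joined_subtype
  have key := hW ⟨t, hj.target_mem⟩ ⟦γ⟧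
  rw [h₁, h₂] at key
  rw [transportFun_map_fiberι f (2 * 1) (hU.mono hWU hWo) ⟦γ⟧ A₁,
    transportFun_map_fiberι f (2 * 2) (hU.mono hWU hWo) ⟦γ⟧ A₂] at key
  exact key

/-- **The variational Hodge conclusion in codimension `2` at a semiregular anchor, on every fibre.**
Let `f : 𝒳 ⟶ S` be a smooth projective family with `𝒳`, `S` quasi-projective, `S` smooth (of relative
dimension `d`) and irreducible; `A₁ ∈ H²(𝒳(ℂ); ℂ)`, `A₂ ∈ H⁴(𝒳(ℂ); ℂ)` global classes with fibre
restrictions of Hodge type `(1,1)`, `(2,2)` at every complex point; and `s₀ ∈ S(ℂ)` an anchor at which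
`A₁|_{𝒳_{s₀}} = ch₁(ℰ₀)`, `A₂|_{𝒳_{s₀}} = ch₂(ℰ₀)` for a finite locally free `{0,1}`-semiregular sheaf
`ℰ₀` on `𝒳_{s₀}`. Then `A₂|_{𝒳_t}` is an algebraic class for EVERY `t ∈ S(ℂ)` — granted
Buchweitz–Flenner's Thm. 5.1 (`hBF`) and the Hilbert-scheme structure of the algebraicity locus
(`hCS`): the local conclusion (`exists_isOpen_forall_mem_algebraicClasses_of_semiregular`) holds on the
path component of `s₀` in `W`, a non-empty open subset of the manifold `S(ℂ)`, and spreads to all of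
`S(ℂ)` by `map_fiberι_mem_algebraicClasses_of_isOpen` (Baire + relative Hilbert schemes).
[cite: BuchweitzFlenner2003, §5 Thm. 5.1] [cite: CharlesSchnell2014Notes, Prop. 11.3.11 (proof)]
[cite: VoisinHodgeII2003, §7.3.2, proof of Thm. 7.19] -/
theorem variationalHodge_conclusion_two_of_semiregular
    (hBF : BuchweitzFlenner2003_variationalHodge_semiregular)
    (hCS : charlesSchnell_algebraicityLocus_iUnion_closed) (C : ChernCharacterBetti)
    (hf : IsSmoothProjectiveFamily f n) (h𝒳 : IsQuasiProjectiveOver 𝒳) (hS : IsQuasiProjectiveOver S)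
    (hSsm : AlgebraicGeometry.Smooth S.hom) [SmoothOfRelativeDimension d S.hom]
    (hirr : IrreducibleSpace S.left)
    (A₁ : complexBetti 𝒳 (2 * 1)) (A₂ : complexBetti 𝒳 (2 * 2))
    (hA₁ : ∀ t : ComplexPoints S,
      IsOfHodgeType n (fiberOver f t) (2 * 1) 1 1 (complexBetti.map (fiberι f t) (2 * 1) A₁))
    (hA₂ : ∀ t : ComplexPoints S,
      IsOfHodgeType n (fiberOver f t) (2 * 2) 2 2 (complexBetti.map (fiberι f t) (2 * 2) A₂))
    (s₀ : ComplexPoints S) (E₀ : (fiberOver f s₀).left.Modules) (hE₀ : IsFiniteLocallyFree E₀)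
    (hsr : IsZeroOneSemiregular hE₀)
    (h₁ : C.ch (fiberOver f s₀) E₀ 1 = complexBetti.map (fiberι f s₀) (2 * 1) A₁)
    (h₂ : C.ch (fiberOver f s₀) E₀ 2 = complexBetti.map (fiberι f s₀) (2 * 2) A₂)
    (t : ComplexPoints S) :
    complexBetti.map (fiberι f t) (2 * 2) A₂ ∈ algebraicClasses (fiberOver f t) 2 := by
  obtain ⟨W, hWo, hW₀, hW⟩ := exists_isOpen_forall_mem_algebraicClasses_of_semiregular (d := d) f hBF C
    hf hS hSsm A₁ A₂ hA₁ hA₂ s₀ E₀ hE₀ hsr h₁ h₂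
  -- `S(ℂ)` is a topological `2d`-manifold, hence locally path connected
  haveI : LocallyOfFiniteType S.hom := hS.locallyOfFiniteType
  letI := ComplexPoints.chartedSpace S d
  haveI : LocallyPathConnectedSpace (ComplexPoints S) :=
    ChartedSpace.locallyPathConnectedSpace (EuclideanSpace ℝ (Fin (2 * d))) (ComplexPoints S)
  exact map_fiberι_mem_algebraicClasses_of_isOpen hCS f h𝒳 hS hSsm hirr hf A₂
    (hWo.pathComponentIn s₀) ⟨s₀, mem_pathComponentIn_self hW₀⟩ (fun u hu => (hW u hu).2) t

end Summit.HodgeConjecture.HodgeConjecture.Theorems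

end
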